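import Summits.QuantumFields.YangMills.Theorems.BalabanUVNodesN15TwoSpacingGluingAdjointDefectGluingCut
import Summits.QuantumFields.YangMills.Theorems.BalabanUVNodesN15TwoSpacingGluingInputLocalized
import HarnessLib

/-!
# ENTRY 2 OF THE ADJOINT GLUED OPERATOR WITH DEFECTS FROM OUTPUT-LOCALIZED ADJOINT COMMUTATOR ROWS `G_□∘[Δ, M_{h_□}] ≤ 1_{S_□}(y)·θ₀e^{−δd}` (FILE 147 §2 ∕ FILE 149 with `hKc`, `hDK` ONE-SIDED —
# the shape FILES 153∕155∕156 deliver for a NONLOCAL `Δ`), one grid and two grids (dag-n15-c g18, FILE 158; N15 = NE2, s1 «background-layer OPERATOR ingredient»)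

Cell `pub-ymgap`, seat `pub-ymgap-dag-n15-c` (R134 (a); HUMAN RULING D-0062), generation 18.  `bears_on: R4∕N15 · K3⁸ SpineGivenEndpointR13SepCoPHV (stmt-QuantumFields-27366)`.
Filed `--kind proof --supports stmt-QuantumFields-27366 --as helper` — COUNT-NEUTRAL.  Theorems only; 0 `def`, 0 `sorry`.  Imports BY NAME FILE 149 `…AdjointDefectGluingCut` (and through it
FILE 147 `hasMaj_defectSumL`, `hasMaj_idef_defectSumL`, `hasMaj_neumannR_comp`, FILE 44 `hasMaj_idef_glueInvL_comp`, FILE 83 `hasMaj_(idef_)parametrix_comp_cut`) and dag-n15-c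
`…TwoSpacingGluingInputLocalized` (`hasMaj_remainderL_out`, `hasMaj_idef_remainderL_out`).  Nothing in the tree is modified; nothing restated.

WHY.  FILE 147 §2 and FILE 149 take the adjoint commutator rows TWO-SIDED localized, `G_□∘[Δ, M_{h_□}] ≤ 1_{S_□}(y)1_{S_□}(y′)·θ₀e^{−δd}` (FILE 49's shape).  For the NONLOCAL model operator
`Δ = lapOp W + N_L − 𝒱` the commutator `[N_L, M_h]` is not localized on the input side, and the rows the adjoint-side cube kit delivers (FILE 153 ★★★ one grid, FILES 155∕156 two grids) are
OUTPUT-localized only: `≤ 1_S(y)·Θe^{−ρd}`.  The bounded-overlap summation `Σ_□` needs no more than that (`…InputLocalized` `hasMaj_remainderL_out` ∕ `hasMaj_idef_remainderL_out`), so THIS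
FILE re-runs FILE 147 §2's two remainder letters and FILE 149's two entry-2 theorems with `hKc`, `hKc′`, `hDK` ONE-SIDED; every other hypothesis and the one-grid constant are unchanged, the
two-grid constant loses a `1*` (`N_ov(r + oθ₀ + (1·r_E + oε))`).

HONEST FRAMING ∕ LIMITS.  Block-majorant bookkeeping over DISPLAYED letters; proves NO estimate of any concrete propagator; nothing of [B5]∕[B6]∕[B9] asserted ((1.120)–(1.128), (2.91)–(2.93)
p.239, (2.133)–(2.136) p.247, (3.42) p.397 = SHAPES; Thm 3.14 pp.426–427 = difference TEMPLATE).  NE2⁺ NOT PRINTED, NOT proved; N15 NOT discharged; K3⁸ OPEN, skeleton v7 untouched (0∕2);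
counts of record UNMOVED by this seat (typed 28∕28 · discharged 7∕28 = 7∕27 excl. NODE O, №245); one finite 𝕋⁴ at fixed ε — NOT infinite volume, NOT OS on ℝ⁴, NOT a mass gap, NOT Clay; R4
closes the conditional finite-𝕋⁴ rung `BalabanLadder.UV` only.  Restate-immune (no Theses import).
-/

set_option autoImplicit false

noncomputable section
open scoped BigOperators

namespace Summit.QuantumFields.YangMills.BalabanUVNodes.N15.Gluing

open Literature.MathematicalPhysics.QuantumFieldTheory.Balaban1983to89
open Literature.MathematicalPhysics.QuantumFieldTheory.Balaban1983to89.B11SectG (BlockNorm HasMaj RowSum)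
open Literature.MathematicalPhysics.QuantumFieldTheory.Balaban1983to89.B6RandomWalk (Triangle254)
open Literature.MathematicalPhysics.QuantumFieldTheory.Balaban1983to89.T4EtaRateDefect (idef idef_sub)
open Literature.MathematicalPhysics.QuantumFieldTheory.Balaban1983to89.T4EtaRateCoeffDefect (pull)
open Literature.MathematicalPhysics.QuantumFieldTheory.Balaban1983to89.B6Prop26Gluing (mulOp ind ind_nonneg)

/-! ## §1 FILE 147 §2's remainder letters from output-localized commutator rows -/

section Letters

variable {X X' : Type} [Fintype X] [Fintype X'] {ι : Type} [Fintype ι] {g : B6.Geometry} (blk : X → g.Site) (π : X' → X) (S : ι → Set g.Site)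

omit [Fintype X'] in
/-- ★ **THE FULL ADJOINT REMAINDER's LETTER, OUTPUT-LOCALIZED COMMUTATOR ROWS**: `G_□∘[Δ, M_{h_□}] ≤ 1_{S_□}(y)·θ₀e^{−δd}`, two-sided defect rows `Ẽ_□ ≤ 1_S1_S·εe^{−δd}`, `|h_□| ≤ 1`, overlap `N_ov`
⟹ `R̃ − Σ_□M_{h_□}Ẽ_□ ≤ N_ov(θ₀ + ε)·e^{−δd}` (FILE 147 `hasMaj_remainderLD` with `…InputLocalized` `hasMaj_remainderL_out`). [cite: Balaban1984PropagatorsII, (2.135) p.247 (shape, transposed)] -/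
theorem hasMaj_remainderLD_out {Δ : (X → ℝ) →ₗ[ℝ] (X → ℝ)} {h : ι → X → ℝ} {G E : ι → (X → ℝ) →ₗ[ℝ] (X → ℝ)} {θ₀ ε δ Nov : ℝ} (hθ : 0 ≤ θ₀) (hε : 0 ≤ ε) (hh : ∀ i x, |h i x| ≤ 1)
    (hN : ∀ a, ∑ i, ind (S i) a ≤ Nov)
    (hKc : ∀ i, HasMaj (BlockNorm.ofBlocks g blk) (BlockNorm.ofBlocks g blk) (G i ∘ₗ commOp Δ (h i)) (fun y y' => ind (S i) y * (θ₀ * Real.exp (-(δ * g.dist y y')))))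
    (hE : ∀ i, HasMaj (BlockNorm.ofBlocks g blk) (BlockNorm.ofBlocks g blk) (E i) (fun y y' => ind (S i) y * ind (S i) y' * (ε * Real.exp (-(δ * g.dist y y'))))) :
    HasMaj (BlockNorm.ofBlocks g blk) (BlockNorm.ofBlocks g blk) (remainderL Δ h G - ∑ i, mulOp (h i) ∘ₗ E i) (fun y y' => Nov * (θ₀ + ε) * Real.exp (-(δ * g.dist y y'))) := by
  refine ((hasMaj_remainderL_out blk S hθ hh hN hKc).sub (hasMaj_defectSumL blk S hε hh hN hE)).mono fun y y' => le_of_eq ?_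
  ring

/-- ★ **THE FULL ADJOINT REMAINDER's η-DEFECT, OUTPUT-LOCALIZED COMMUTATOR ROWS AND DEFECTS**: `…InputLocalized` `hasMaj_idef_remainderL_out` (`N_ov(r + oθ₀)`) plus FILE 147 `hasMaj_idef_defectSumL`
⟹ `𝔇(R̃′_D, R̃_D) ≤ N_ov(r + oθ₀ + (1·r_E + oε))·e^{−δd}`. [cite: Balaban1985BackgroundPropagators, Thm 3.14 pp.426–427 (template); Balaban1984PropagatorsII, (2.134)–(2.135) p.247 (shapes)] -/
theorem hasMaj_idef_remainderLD_out {Δ : (X → ℝ) →ₗ[ℝ] (X → ℝ)} {Δ' : (X' → ℝ) →ₗ[ℝ] (X' → ℝ)} {h : ι → X → ℝ} {h' : ι → X' → ℝ} {G E : ι → (X → ℝ) →ₗ[ℝ] (X → ℝ)}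
    {G' E' : ι → (X' → ℝ) →ₗ[ℝ] (X' → ℝ)} {θ₀ r ε rE o δ Nov : ℝ} (hθ : 0 ≤ θ₀) (hr : 0 ≤ r) (hε : 0 ≤ ε) (hrE : 0 ≤ rE) (ho : 0 ≤ o) (hh' : ∀ i x', |h' i x'| ≤ 1)
    (hfit : ∀ i x', |h' i x' - h i (π x')| ≤ o) (hN : ∀ a, ∑ i, ind (S i) a ≤ Nov)
    (hKc : ∀ i, HasMaj (BlockNorm.ofBlocks g blk) (BlockNorm.ofBlocks g blk) (G i ∘ₗ commOp Δ (h i)) (fun y y' => ind (S i) y * (θ₀ * Real.exp (-(δ * g.dist y y')))))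
    (hDK : ∀ i, HasMaj (BlockNorm.ofBlocks g blk) (BlockNorm.ofBlocks g (blk ∘ π)) (idef (pull π) (pull π) (G' i ∘ₗ commOp Δ' (h' i)) (G i ∘ₗ commOp Δ (h i)))
      (fun y y' => ind (S i) y * (r * Real.exp (-(δ * g.dist y y')))))
    (hE : ∀ i, HasMaj (BlockNorm.ofBlocks g blk) (BlockNorm.ofBlocks g blk) (E i) (fun y y' => ind (S i) y * ind (S i) y' * (ε * Real.exp (-(δ * g.dist y y')))))
    (hDE : ∀ i, HasMaj (BlockNorm.ofBlocks g blk) (BlockNorm.ofBlocks g (blk ∘ π)) (idef (pull π) (pull π) (E' i) (E i)) (fun y y' => ind (S i) y * ind (S i) y' * (rE * Real.exp (-(δ * g.dist y y'))))) :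
    HasMaj (BlockNorm.ofBlocks g blk) (BlockNorm.ofBlocks g (blk ∘ π))
      (idef (pull π) (pull π) (remainderL Δ' h' G' - ∑ i, mulOp (h' i) ∘ₗ E' i) (remainderL Δ h G - ∑ i, mulOp (h i) ∘ₗ E i))
      (fun y y' => Nov * (r + o * θ₀ + (1 * rE + o * ε)) * Real.exp (-(δ * g.dist y y'))) := by
  rw [idef_sub]
  refine ((hasMaj_idef_remainderL_out blk π S hθ hr ho hh' hfit hN hKc hDK).sub (hasMaj_idef_defectSumL blk π S hε hrE ho hh' hfit hN hE hDE)).mono fun y y' => le_of_eq ?_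
  ring

end Letters

/-! ## §2 FILE 149's entry-2 theorems from output-localized commutator rows -/

section Entry

variable {X X' : Type} [Fintype X] [Fintype X'] [DecidableEq X] [DecidableEq X'] {ι : Type} [Fintype ι] {g : B6.Geometry} (blk : X → g.Site) (π : X' → X)
  (S : ι → Set g.Site) {σ cr : ℝ}

omit [Fintype X'] [DecidableEq X'] in
/-- ★★ **ENTRY 2 OF THE ADJOINT GLUED OPERATOR WITH DEFECTS, FROM CUT ∕ SANDWICHED ROWS AND OUTPUT-LOCALIZED COMMUTATOR ROWS, ONE GRID**: FILE 149 ★★ verbatim except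
`hKc : G_□∘[Δ, M_{h_□}] ≤ 1_{S_□}(y)·θ₀e^{−δd}` (one-sided) ⟹ `glueInvL (R̃ − Σ_□M_{h_□}Ẽ_□) (Σ_□M_hG_□M_h) ∘ E ≤ (1 − N_ov(θ₀+ε)c_r)⁻¹·N_ov(β₂c_s + βc_d)·c_r·e^{−(δ−2σ)d}`.
[cite: Balaban1984PropagatorsII, (2.37) p.229, (2.91)–(2.93) p.239, Prop. 2.6 (2.133)–(2.136) p.247 (shapes + mechanism, transposed); Balaban1985BackgroundPropagators, (3.42) p.397 (entry `G∇*_U`: shape)] -/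
theorem hasMaj_glueInvL_parametrix_comp_cut_of_defect_out (htri : Triangle254 g) (hd : ∀ a b : g.Site, 0 ≤ g.dist a b) (hd0 : ∀ y : g.Site, g.dist y y = 0) (hrow : RowSum g σ cr)
    (hσ : 0 ≤ σ) {Δ E : (X → ℝ) →ₗ[ℝ] (X → ℝ)} {h hs dh χ : ι → X → ℝ} {G T₂ Ed : ι → (X → ℝ) →ₗ[ℝ] (X → ℝ)} {β β₂ cs cd θ₀ ε δ Nov : ℝ} (hβ : 0 ≤ β) (hβ₂ : 0 ≤ β₂)
    (hcs : 0 ≤ cs) (hcd : 0 ≤ cd) (hθ : 0 ≤ θ₀) (hε : 0 ≤ ε) (hNov : 0 ≤ Nov) (hσδ : 2 * σ ≤ δ) (hleib : ∀ i, mulOp (h i) ∘ₗ E = E ∘ₗ mulOp (hs i) + mulOp (dh i))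
    (hcut : ∀ i, mulOp (h i) ∘ₗ mulOp (χ i) = mulOp (h i)) (hE2 : ∀ i, mulOp (χ i) ∘ₗ G i ∘ₗ E ∘ₗ mulOp (hs i) = T₂ i ∘ₗ mulOp (hs i))
    (hh : ∀ i x, |h i x| ≤ 1) (hhs : ∀ i x, |hs i x| ≤ cs) (hdh : ∀ i x, |dh i x| ≤ cd) (hN : ∀ a, ∑ i, ind (S i) a ≤ Nov)
    (hGc : ∀ i, HasMaj (BlockNorm.ofBlocks g blk) (BlockNorm.ofBlocks g blk) (mulOp (χ i) ∘ₗ G i) (fun y y' => ind (S i) y * ind (S i) y' * (β * Real.exp (-(δ * g.dist y y')))))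
    (hT2 : ∀ i, HasMaj (BlockNorm.ofBlocks g blk) (BlockNorm.ofBlocks g blk) (T₂ i) (fun y y' => ind (S i) y * ind (S i) y' * (β₂ * Real.exp (-(δ * g.dist y y')))))
    (hKc : ∀ i, HasMaj (BlockNorm.ofBlocks g blk) (BlockNorm.ofBlocks g blk) (G i ∘ₗ commOp Δ (h i)) (fun y y' => ind (S i) y * (θ₀ * Real.exp (-(δ * g.dist y y')))))
    (hEd : ∀ i, HasMaj (BlockNorm.ofBlocks g blk) (BlockNorm.ofBlocks g blk) (Ed i) (fun y y' => ind (S i) y * ind (S i) y' * (ε * Real.exp (-(δ * g.dist y y')))))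
    (hq : Nov * (θ₀ + ε) * cr < 1) :
    HasMaj (BlockNorm.ofBlocks g blk) (BlockNorm.ofBlocks g blk) (glueInvL (remainderL Δ h G - ∑ i, mulOp (h i) ∘ₗ Ed i) (parametrix h G) ∘ₗ E)
      (fun y y' => (1 - Nov * (θ₀ + ε) * cr)⁻¹ * (Nov * (β₂ * cs + β * cd)) * cr * Real.exp (-((δ - 2 * σ) * g.dist y y'))) := by
  have hP := hasMaj_parametrix_comp_cut blk S hβ hβ₂ hcs hcd hleib hcut hE2 hh hhs hdh hN hGc hT2
  rw [glueInvL, LinearMap.comp_assoc]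
  exact hasMaj_neumannR_comp blk htri hd hd0 hrow hσ (by positivity) (mul_nonneg hNov (add_nonneg hθ hε)) hσδ hP (hasMaj_remainderLD_out blk S hθ hε hh hN hKc hEd) hq

/-- ★★★ **… AND ITS TWO-SPACING η-DEFECT, FROM CUT ∕ SANDWICHED ROWS AND OUTPUT-LOCALIZED COMMUTATOR ROWS ∕ DEFECTS** (two grids along `π`): FILE 149 ★★★ verbatim except `hKc`, `hKc′`, `hDK`
one-sided ⟹ `𝔇_π(Ñ′∘(G₀′∘E′), Ñ∘(G₀∘E)) ≤ [(1−q)⁻¹m̂c_r + (1−q)⁻¹(r̂((1−q)⁻¹Âc_r)c_r)c_r]·e^{−(δ−2σ)d}`, `q = N_ov(θ₀+ε)c_r`, `Â = N_ov(β₂c_s + βc_d)`, `r̂ = N_ov(r + oθ₀ + (1·r_E + oε))`,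
`m̂ = N_ov[(1·β₂o_s + 1·m₂c_s + oβ₂c_s) + (1·βo_d + 1·m₀c_d + oβc_d)]`. [cite: Balaban1985BackgroundPropagators, Thm 3.14 pp.426–427 (difference template), (3.42) p.397; Balaban1984PropagatorsII, (2.91)–(2.93) p.239, (2.133)–(2.136) p.247] -/
theorem hasMaj_idef_glueInvL_parametrix_comp_cut_of_defect_out (htri : Triangle254 g) (hd : ∀ a b : g.Site, 0 ≤ g.dist a b) (hd0 : ∀ y : g.Site, g.dist y y = 0) (hrow : RowSum g σ cr)
    (hσ : 0 ≤ σ) (hcr : 0 ≤ cr) {Δ E : (X → ℝ) →ₗ[ℝ] (X → ℝ)} {Δ' E' : (X' → ℝ) →ₗ[ℝ] (X' → ℝ)} {h hs dh χ : ι → X → ℝ} {h' hs' dh' χ' : ι → X' → ℝ}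
    {G T₂ Ed : ι → (X → ℝ) →ₗ[ℝ] (X → ℝ)} {G' T₂' Ed' : ι → (X' → ℝ) →ₗ[ℝ] (X' → ℝ)} {β β₂ cs cd o os od m₀ m₂ θ₀ ε r rE δ Nov : ℝ} (hβ : 0 ≤ β) (hβ₂ : 0 ≤ β₂) (hcs : 0 ≤ cs)
    (hcd : 0 ≤ cd) (ho : 0 ≤ o) (hos : 0 ≤ os) (hod : 0 ≤ od) (hm₀ : 0 ≤ m₀) (hm₂ : 0 ≤ m₂) (hθ : 0 ≤ θ₀) (hε : 0 ≤ ε) (hr : 0 ≤ r) (hrE : 0 ≤ rE) (hNov : 0 ≤ Nov) (hσδ : 2 * σ ≤ δ)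
    (hleib : ∀ i, mulOp (h i) ∘ₗ E = E ∘ₗ mulOp (hs i) + mulOp (dh i)) (hleib' : ∀ i, mulOp (h' i) ∘ₗ E' = E' ∘ₗ mulOp (hs' i) + mulOp (dh' i))
    (hcut : ∀ i, mulOp (h i) ∘ₗ mulOp (χ i) = mulOp (h i)) (hcut' : ∀ i, mulOp (h' i) ∘ₗ mulOp (χ' i) = mulOp (h' i))
    (hE2 : ∀ i, mulOp (χ i) ∘ₗ G i ∘ₗ E ∘ₗ mulOp (hs i) = T₂ i ∘ₗ mulOp (hs i)) (hE2' : ∀ i, mulOp (χ' i) ∘ₗ G' i ∘ₗ E' ∘ₗ mulOp (hs' i) = T₂' i ∘ₗ mulOp (hs' i))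
    (hh : ∀ i x, |h i x| ≤ 1) (hh' : ∀ i x', |h' i x'| ≤ 1) (hhs : ∀ i x, |hs i x| ≤ cs) (hdh : ∀ i x, |dh i x| ≤ cd)
    (hfit : ∀ i x', |h' i x' - h i (π x')| ≤ o) (hfits : ∀ i x', |hs' i x' - hs i (π x')| ≤ os) (hfitd : ∀ i x', |dh' i x' - dh i (π x')| ≤ od) (hN : ∀ b, ∑ i, ind (S i) b ≤ Nov)
    (hGc : ∀ i, HasMaj (BlockNorm.ofBlocks g blk) (BlockNorm.ofBlocks g blk) (mulOp (χ i) ∘ₗ G i) (fun y y' => ind (S i) y * ind (S i) y' * (β * Real.exp (-(δ * g.dist y y')))))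
    (hGc' : ∀ i, HasMaj (BlockNorm.ofBlocks g (blk ∘ π)) (BlockNorm.ofBlocks g (blk ∘ π)) (mulOp (χ' i) ∘ₗ G' i)
      (fun y y' => ind (S i) y * ind (S i) y' * (β * Real.exp (-(δ * g.dist y y')))))
    (hT2 : ∀ i, HasMaj (BlockNorm.ofBlocks g blk) (BlockNorm.ofBlocks g blk) (T₂ i) (fun y y' => ind (S i) y * ind (S i) y' * (β₂ * Real.exp (-(δ * g.dist y y')))))
    (hT2' : ∀ i, HasMaj (BlockNorm.ofBlocks g (blk ∘ π)) (BlockNorm.ofBlocks g (blk ∘ π)) (T₂' i) (fun y y' => ind (S i) y * ind (S i) y' * (β₂ * Real.exp (-(δ * g.dist y y')))))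
    (hIGc : ∀ i, HasMaj (BlockNorm.ofBlocks g blk) (BlockNorm.ofBlocks g (blk ∘ π)) (idef (pull π) (pull π) (mulOp (χ' i) ∘ₗ G' i) (mulOp (χ i) ∘ₗ G i))
      (fun y y' => ind (S i) y * ind (S i) y' * (m₀ * Real.exp (-(δ * g.dist y y')))))
    (hIT2 : ∀ i, HasMaj (BlockNorm.ofBlocks g blk) (BlockNorm.ofBlocks g (blk ∘ π)) (idef (pull π) (pull π) (T₂' i) (T₂ i))
      (fun y y' => ind (S i) y * ind (S i) y' * (m₂ * Real.exp (-(δ * g.dist y y')))))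
    (hKc : ∀ i, HasMaj (BlockNorm.ofBlocks g blk) (BlockNorm.ofBlocks g blk) (G i ∘ₗ commOp Δ (h i)) (fun y y' => ind (S i) y * (θ₀ * Real.exp (-(δ * g.dist y y')))))
    (hKc' : ∀ i, HasMaj (BlockNorm.ofBlocks g (blk ∘ π)) (BlockNorm.ofBlocks g (blk ∘ π)) (G' i ∘ₗ commOp Δ' (h' i)) (fun y y' => ind (S i) y * (θ₀ * Real.exp (-(δ * g.dist y y')))))
    (hDK : ∀ i, HasMaj (BlockNorm.ofBlocks g blk) (BlockNorm.ofBlocks g (blk ∘ π)) (idef (pull π) (pull π) (G' i ∘ₗ commOp Δ' (h' i)) (G i ∘ₗ commOp Δ (h i)))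
      (fun y y' => ind (S i) y * (r * Real.exp (-(δ * g.dist y y')))))
    (hEd : ∀ i, HasMaj (BlockNorm.ofBlocks g blk) (BlockNorm.ofBlocks g blk) (Ed i) (fun y y' => ind (S i) y * ind (S i) y' * (ε * Real.exp (-(δ * g.dist y y')))))
    (hEd' : ∀ i, HasMaj (BlockNorm.ofBlocks g (blk ∘ π)) (BlockNorm.ofBlocks g (blk ∘ π)) (Ed' i) (fun y y' => ind (S i) y * ind (S i) y' * (ε * Real.exp (-(δ * g.dist y y')))))
    (hDEd : ∀ i, HasMaj (BlockNorm.ofBlocks g blk) (BlockNorm.ofBlocks g (blk ∘ π)) (idef (pull π) (pull π) (Ed' i) (Ed i)) (fun y y' => ind (S i) y * ind (S i) y' * (rE * Real.exp (-(δ * g.dist y y')))))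
    (hq : Nov * (θ₀ + ε) * cr < 1) :
    HasMaj (BlockNorm.ofBlocks g blk) (BlockNorm.ofBlocks g (blk ∘ π))
      (idef (pull π) (pull π) (glueInvL (remainderL Δ' h' G' - ∑ i, mulOp (h' i) ∘ₗ Ed' i) (parametrix h' G') ∘ₗ E')
        (glueInvL (remainderL Δ h G - ∑ i, mulOp (h i) ∘ₗ Ed i) (parametrix h G) ∘ₗ E))
      (fun y y' => ((1 - Nov * (θ₀ + ε) * cr)⁻¹ * (Nov * ((1 * β₂ * os + 1 * m₂ * cs + o * β₂ * cs) + (1 * β * od + 1 * m₀ * cd + o * β * cd))) * cr +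
          (1 - Nov * (θ₀ + ε) * cr)⁻¹ * ((Nov * (r + o * θ₀ + (1 * rE + o * ε))) * ((1 - Nov * (θ₀ + ε) * cr)⁻¹ * (Nov * (β₂ * cs + β * cd)) * cr) * cr) * cr) *
        Real.exp (-((δ - 2 * σ) * g.dist y y'))) := by
  have hP := hasMaj_parametrix_comp_cut blk S hβ hβ₂ hcs hcd hleib hcut hE2 hh hhs hdh hN hGc hT2
  have hIP := hasMaj_idef_parametrix_comp_cut blk π S hβ hβ₂ hcs hcd ho hos hod hm₀ hm₂ hleib hleib' hcut hcut' hE2 hE2' hh' hhs hdh hfit hfits hfitd hN hGc hGc' hT2 hT2' hIGc hIT2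
  rw [glueInvL, glueInvL, LinearMap.comp_assoc, LinearMap.comp_assoc]
  exact hasMaj_idef_glueInvL_comp blk π htri hd hd0 hrow hσ hcr (by positivity) (mul_nonneg hNov (add_nonneg hθ hε)) (mul_nonneg hNov (by positivity)) (mul_nonneg hNov (by positivity)) hσδ hP
    (hasMaj_remainderLD_out blk S hθ hε hh hN hKc hEd) (hasMaj_remainderLD_out (blk ∘ π) S hθ hε hh' hN hKc' hEd') hIP
    (hasMaj_idef_remainderLD_out blk π S hθ hr hε hrE ho hh' hfit hN hKc hDK hEd hDEd) hq

end Entry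

end Summit.QuantumFields.YangMills.BalabanUVNodes.N15.Gluing

end
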